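import Summits.HodgeConjecture.CorCM.D2Bridge.AlbaneseOnPieceCore
import Literature.NumberTheory.Automorphic.Liu2021.AppendixC.AlbaneseH1Comparison
import Literature.NumberTheory.Automorphic.Liu2021.Lemma24BettiAlbanese
import Literature.NumberTheory.Automorphic.Liu2021.NablaOfPieces
import Literature.AlgebraicGeometry.HodgeTheory.ComplexBettiMapOfRationalBijective
import Literature.AlgebraicGeometry.HodgeTheory.SmoothProjectiveComponents
import Literature.AlgebraicGeometry.Motives.JacobianDimensionProofs
import Literature.AlgebraicGeometry.Motives.AbelianVarietyProjectiveChart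
import Literature.AlgebraicGeometry.Motives.BaseChangeProofs
import Literature.AlgebraicGeometry.Motives.BettiCofanAdditivity
import Literature.AlgebraicTopology.SingularHomology.CohomologyDisjointOpenCover
import Literature.AlgebraicTopology.SingularHomology.HOneProducts
import Literature.NumberTheory.Transcendental.Analytification
import HarnessLib

/-!
# `H¹_{B,τ'}(Alb_X, ℂ) ≅ H¹_{B,τ'}(X, ℂ)`, the comparison FAMILY, CONSTRUCTED from [Liu2021] Lemma 2.4 (1)
# (cell hodgecm-mathlib, INVENTORY row III-0 = B3-01: the term `AlbaneseH1ComparisonFamily k τ'`)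

File `Summits/HodgeConjecture/CorCM/HypLiu418/` (next to the consumers of `stub_bettiThetaModel`), namespace
`Summit.HodgeConjecture.CorCM.D2Bridge` (it extends the generic core `D2Bridge/AlbaneseOnPieceCore` it is built on; Literature files
may not import Summits, so the construction lands Summits-side and is consumed BY NAME by the cell's junction).

[Liu2021] = Yifeng Liu, *Fourier–Jacobi cycles and arithmetic relative trace formula*, Camb. J. Math. **9** (2021)
= arXiv:2102.11518 (`FJcycle.tex` line numbers as in `AppendixC/Glue.lean`).  Lemma 2.4 (1) (l. 1210–1228): «for every
homomorphism `τ : k → ℂ`, we have a canonical isomorphism `H¹_{B,τ}(Alb_X, ℚ) ≃ H¹_{B,τ}(X, ℚ)` […] we pick an element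
`x ∈ X(π₀(X ⊗_{k,τ} ℂ))`, which induces a morphism `(α_X)_x : X ⊗_{k,τ} ℂ → Alb_X ⊗_{k,τ} ℂ` […] `(α_X)^*_x` is an
isomorphism; it is independent of the choice of `x` since translation acts trivially on `H¹_{B,τ}(Alb, ℚ)`».

The tree carries Lemma 2.4 (1) as the POINTED, `ℚ`-coefficient NAMED FACT `Liu2021.albanese_bettiOne_pullback_bijective`
(`Liu2021/Lemma24BettiAlbanese`) and the hypothesis STRUCTURE `AppendixC.AlbaneseH1ComparisonFamily k τ'` (B-typ02, p598887:
ONE `ℂ`-linear `cmp X a : H¹_{B,τ'}(Alb_X, ℂ) → H¹_{B,τ'}(X, ℂ)` per `(X, a)`, bijective on smooth projective `X`, natural for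
α-compatible pairs).  THIS FILE CONSTRUCTS THE FAMILY FROM THE NAMED FACT (director 2026-08-28T02:43:27Z (α), ref2 02:47:57Z):

* §1 `AlbanesePieces X` — the binders of the named fact, bundled: a finite colimit cofan `inj q : Y q ⟶ X ⊗_k ℂ` of smooth
  projective geometrically irreducible complex pieces with points `pt q ∈ Y_q(ℂ)`; `nonempty_albanesePieces` — they EXIST for `X`
  smooth (of some relative dimension) and projective over `k` (tree `HodgeTheory.exists_components_isSmoothProjective_isColimit` for
  `X ⊗_k ℂ`, `nonempty_algPoints_of_isSmoothProjective`).  The lifts `ℓ q : Y_q × Y_q ⟶ (∇X)_ℂ` and Liu's `(α_X)_x|_{Y_q}` are the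
  tree's `D2Bridge.nablaLiftPiece` / `D2Bridge.albOnPiece` (`Summits/…/CorCM/D2Bridge/AlbaneseOnPieceCore`, generic, Literature-only
  imports); `albAt D a : X ⊗_k ℂ ⟶ Alb_X ⊗_k ℂ` glues them over the cofan — Liu's `(α_X)_x`.
* §2 `pull_albAt_bijective` — the named fact, APPLIED (hypothesis `h : albanese_bettiOne_pullback_bijective` BY NAME):
  `(α_X)_x^*` bijective on `H¹(−; ℚ)`; `complexBetti_map_albAt_bijective` — hence on `H¹(−; ℂ)` (universal coefficients `ℚ → ℂ`,
  `HodgeTheory.bijective_complexBetti_map_of_bijective_pull`, finiteness of `H₁` of the compact manifolds `X_ℂ(ℂ)`, `Alb_ℂ(ℂ)`).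
* §3 `complexBetti_map_eq_of_forall_inj` — a class on `X_ℂ(ℂ)` is determined by its restrictions to the pieces (cohomology is
  additive over the clopen partition `X_ℂ(ℂ) = ⊔ Y_q(ℂ)`, `singularCohomology.piRestrict_bijective`; the `ℂ`-coefficient twin of
  `Motives.BettiCofan.bijective_pi_pull`); `exists_factor_inj` — a morphism from an irreducible piece into `Z ⊗_k ℂ` factors through
  ONE piece of `Z ⊗_k ℂ`.
* §4 `complexBetti_map_albAt_natural` — **naturality**: for α-compatible `(v, nv, φ)` from `(X, a)` to `(Z, b)` (Def. 2.3:
  «`Alb_u ∘ α = α ∘ ∇u`»), `((α_X)_x ≫ φ_ℂ)^* = (v_ℂ ≫ (α_Z)_{x'})^*` on `H¹(Alb_Z ⊗ ℂ(ℂ); ℂ)`: on each piece `Y_q` of `X_ℂ` (factor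
  `Y_q → X_ℂ → Z_ℂ` through a piece `Y'_{q'}`), the transition square `D2Bridge.albOnPiece_comp_baseChange` and the base-point change
  `D2Bridge.albOnPiece_eq_mul_const` («independent of the choice of `x` since translation acts trivially», `complexBetti_map_mul_const`).
* §5 `cmp`, **`albaneseH1ComparisonFamily_of_lemma24 (h) (k) (τ')  : AlbaneseH1ComparisonFamily k τ'`** — `cmp X a :=
  ((α_X)_x)^*` for CHOSEN pieces when `X` is smooth projective, `0` otherwise (the structure constrains `cmp` only on smooth
  projective `X`).

Definitions with bodies and theorems; NO named fact (debt Δ 0: the row's debt carrier is the existing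
`albanese_bettiOne_pullback_bijective`, consumed as the hypothesis `h`); no instance, no notation, no `sorry`.  HC_CM is proved only
modulo the 7 printed citations until rung 0 closes; nothing of [Liu2021] is discharged here.

## References

* [Liu2021] Y. Liu, arXiv:2102.11518 = Camb. J. Math. 9 (2021): Def. 2.1 (1)–(3) (l. 1171–1184), Def. 2.3 (l. 1202–1208),
  Lemma 2.4 (1) with proof (l. 1210–1228).
* [HatcherAT2002] A. Hatcher, *Algebraic Topology* (2002), §3.1 p. 198 (coefficients), p. 201 (homotopy invariance), p. 202
  (`Hⁿ(∐ X_α) ≅ ∏ Hⁿ(X_α)`).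
* [BirkenhakeLange2004] C. Birkenhake, H. Lange, *Complex Abelian Varieties*, §11.11 (Albanese; cite-only).
* [GortzWedhorn2020] U. Görtz, T. Wedhorn, *Algebraic Geometry I*, §(3.5) Example 3.11 (coproducts of schemes).
-/

set_option autoImplicit false

noncomputable section

open CategoryTheory CategoryTheory.Limits AlgebraicGeometry MonoidalCategory CartesianMonoidalCategory Function
open Literature.AlgebraicGeometry.Motives
open Literature.AlgebraicGeometry.HodgeTheory
open Literature.AlgebraicTopology.SingularHomology
open scoped MonObj

namespace Summit.HodgeConjecture.CorCM.D2Bridge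

open AbelianVariety (bcSpec bcFunctor)
open Literature.NumberTheory.Automorphic.Liu2021 Literature.NumberTheory.Automorphic.Liu2021.AppendixC

variable {k : Type} [Field k] [Algebra k ℂ]

/-! ## §1 The pieces of `X ⊗_k ℂ` with base points, and Liu's `(α_X)_x` -/

/-- **The binders of Lemma 2.4 (1), bundled**: a finite colimit cofan `inj q : Y q ⟶ X ⊗_k ℂ` of smooth projective geometrically
irreducible complex pieces (`d` their common dimension), with one complex point `pt q` on each — «`x ∈ X(π₀(X ⊗_{k,τ} ℂ))`».
[cite: Liu2021, proof of Lemma 2.4 (1) (FJcycle.tex l. 1220–1222)] -/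
structure AlbanesePieces (X : SchemeOver k) : Type 1 where
  /-- the index set of the pieces -/
  Ξ : Type
  /-- finitely many pieces -/
  finite : Finite Ξ
  /-- the common dimension of the pieces -/
  d : ℕ
  /-- the pieces -/
  Y : Ξ → SchemeOver ℂ
  /-- each piece is a smooth projective geometrically irreducible complex variety -/
  smoothProjective : ∀ q, IsSmoothProjective d (Y q)
  /-- the legs `Y q ⟶ X ⊗_k ℂ` -/
  inj : ∀ q, Y q ⟶ (bcFunctor k ℂ).obj X
  /-- the legs form a coproduct -/
  isColimit : IsColimit (Cofan.mk ((bcFunctor k ℂ).obj X) inj)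
  /-- one complex point on each piece -/
  pt : ∀ q, AlgPoints (Y q) ℂ

namespace AlbanesePieces

variable {X : SchemeOver k} (D : AlbanesePieces X) (a : Albanese X)

/-- The pieces are geometrically irreducible. [cite: Liu2021, §2.1 Def. 2.1 (2) (l. 1175–1177)] -/
theorem geometricallyIrreducible (q : D.Ξ) : GeometricallyIrreducible (D.Y q).hom :=
  (D.smoothProjective q).geometricallyIrreducible

/-- **`(α_X)_x` on the piece `Y_q`**: `y ↦ α_X(y, x_q)` (the tree's `D2Bridge.albOnPiece` at the chosen point).
[cite: Liu2021, proof of Lemma 2.4 (1) (l. 1220–1222)] -/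
def albOnPieceAt (q : D.Ξ) : D.Y q ⟶ (a.Alb.baseChange ℂ).X :=
  haveI := D.geometricallyIrreducible q
  albOnPiece a (D.inj q) (D.pt q)

/-- **Liu's `(α_X)_x : X ⊗_k ℂ ⟶ Alb_X ⊗_k ℂ`**, glued from the pieces over the coproduct. [cite: Liu2021, proof of Lemma 2.4 (1) (l. 1220–1222)] -/
def albAt : (bcFunctor k ℂ).obj X ⟶ (a.Alb.baseChange ℂ).X :=
  D.isColimit.desc (Cofan.mk _ fun q ↦ D.albOnPieceAt a q)

/-- On the piece `Y_q`, `(α_X)_x` is `y ↦ α_X(y, x_q)`. [cite: Liu2021, proof of Lemma 2.4 (1) (l. 1220–1222)] -/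
@[reassoc]
theorem inj_albAt (q : D.Ξ) : D.inj q ≫ D.albAt a = D.albOnPieceAt a q :=
  D.isColimit.fac (Cofan.mk _ fun q ↦ D.albOnPieceAt a q) ⟨q⟩

end AlbanesePieces

/-- **Pieces with base points EXIST for `X` smooth projective over `k`**: `X ⊗_k ℂ` is smooth of relative dimension `d` and
projective over `ℂ` (base change), hence the finite coproduct of its connected components, which are smooth projective geometrically
irreducible (`HodgeTheory.exists_components_isSmoothProjective_isColimit`), each with a complex point (Nullstellensatz,
`nonempty_algPoints_of_isSmoothProjective`). [cite: Liu2021, §2.1 Def. 2.1 (2) and proof of Lemma 2.4 (1) (l. 1175–1177, 1220–1222)]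
[cite: GortzWedhorn2020, §(3.5) Example 3.11] -/
theorem nonempty_albanesePieces {d : ℕ} (X : SchemeOver k) [SmoothOfRelativeDimension d X.hom] (hX : IsProjectiveOver X) :
    Nonempty (AlbanesePieces X) := by
  have := smoothOfRelativeDimension_isStableUnderBaseChange d
  haveI : SmoothOfRelativeDimension d ((bcFunctor k ℂ).obj X).hom :=
    MorphismProperty.pullback_snd (P := @SmoothOfRelativeDimension d) _ _ ‹_›
  obtain ⟨C, hC, E, e, hE, -, -, -, ⟨hcol⟩⟩ :=
    exists_components_isSmoothProjective_isColimit (d := d) (X := (bcFunctor k ℂ).obj X) (hX.baseChange_obj ℂ)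
  exact ⟨⟨C, hC, d, E, hE, e, hcol, fun c ↦ (nonempty_algPoints_of_isSmoothProjective (hE c)).some⟩⟩

/-! ## §2 Lemma 2.4 (1) applied: `(α_X)_x^*` is bijective on `H¹(−; ℚ)`, hence on `H¹(−; ℂ)` -/

namespace AlbanesePieces

variable {X : SchemeOver k} (D : AlbanesePieces X) (a : Albanese X)

/-- **[Liu2021, Lemma 2.4 (1)] for the chosen pieces and points**: `(α_X)_x^* : H¹((Alb_X ⊗ ℂ)(ℂ); ℚ) → H¹((X ⊗ ℂ)(ℂ); ℚ)` is a
bijection, for `X` proper smooth over `k` of characteristic zero — the named fact `albanese_bettiOne_pullback_bijective` BY NAME,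
at the lifts `D2Bridge.nablaLiftPiece`. [cite: Liu2021, Lemma 2.4 (1) (l. 1210–1213) with proof (l. 1220–1228)] -/
theorem pull_albAt_bijective (h : albanese_bettiOne_pullback_bijective) [CharZero k] [IsProper X.hom] [Smooth X.hom] :
    Bijective (BettiUniverse.pull (D.albAt a) 1) := by
  haveI : ∀ q, GeometricallyIrreducible (D.Y q).hom := D.geometricallyIrreducible
  exact h k X ‹_› ‹_› a D.Ξ D.Y D.inj D.isColimit D.pt (fun q ↦ nablaLiftPiece a (D.inj q))
    (fun q ↦ nablaLiftPiece_incl a (D.inj q)) (D.albAt a) (fun q ↦ D.inj_albAt a q)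

/-- **`(α_X)_x^* : H¹((Alb_X ⊗ ℂ)(ℂ); ℂ) → H¹((X ⊗ ℂ)(ℂ); ℂ)` is a bijection** for `X` smooth projective over `k ⊆ ℂ` — Lemma 2.4 (1)
with `ℂ`-coefficients (universal coefficients: `HodgeTheory.bijective_complexBetti_map_of_bijective_pull`; `H₁(−; ℚ)` of the compact
manifolds `X_ℂ(ℂ)`, `Alb_ℂ(ℂ)` is finite-dimensional). [cite: Liu2021, Lemma 2.4 (1) (l. 1210–1213)] [cite: HatcherAT2002, §3.1 Thm. 3.2 and p. 198] -/
theorem complexBetti_map_albAt_bijective (h : albanese_bettiOne_pullback_bijective) {d : ℕ} [SmoothOfRelativeDimension d X.hom]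
    (hX : IsProjectiveOver X) : Bijective (complexBetti.map (D.albAt a) 1).hom := by
  haveI : CharZero k := RingHom.charZero (algebraMap k ℂ)
  haveI : IsProper X.hom := hX.isProper
  haveI : Smooth X.hom := SmoothOfRelativeDimension.smooth d X.hom
  have := smoothOfRelativeDimension_isStableUnderBaseChange d
  haveI : SmoothOfRelativeDimension d ((bcFunctor k ℂ).obj X).hom :=
    MorphismProperty.pullback_snd (P := @SmoothOfRelativeDimension d) _ _ ‹_›
  haveI : IsProper ((bcFunctor k ℂ).obj X).hom := MorphismProperty.pullback_snd (P := @IsProper) _ _ ‹_›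
  haveI := finite_singularHomology_rat_complexPoints_of_proper ((bcFunctor k ℂ).obj X) (n := d) 1
  haveI := finite_singularHomology_rat_complexPoints
    (AbelianVariety.isSmoothProjective_holds (A := a.Alb.baseChange ℂ)) 1
  exact bijective_complexBetti_map_of_bijective_pull (D.albAt a) 1 (D.pull_albAt_bijective a h)

end AlbanesePieces

/-! ## §3 Classes on `X ⊗ ℂ` are determined on the pieces; morphisms from a piece factor through a piece -/

section Pieces

universe v

variable {X' : SchemeOver ℂ} {κ : Type v} [Small.{0} κ] {Y : κ → SchemeOver ℂ} {inj : ∀ c, Y c ⟶ X'}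

/-- **A class in `Hⁿ(X'(ℂ); ℂ)` is determined by its restrictions to the legs of a colimit cofan** `inj c : Y c ⟶ X'` (the complex
points of the legs form a clopen partition, `BettiCofan.isClopenPartition_range_map`; cohomology of a disjoint open decomposition is
the product, `singularCohomology.piRestrict_bijective`) — the `ℂ`-coefficient twin of `BettiCofan.eq_zero_of_forall_pull_eq_zero`.
[cite: HatcherAT2002, §3.1 p. 202] [cite: GortzWedhorn2020, §(3.5) Example 3.11] -/
theorem complexBetti_eq_zero_of_forall_map_inj (hcol : IsColimit (Cofan.mk X' inj)) {n : ℕ} {z : complexBetti X' n}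
    (hz : ∀ c, (complexBetti.map (inj c) n).hom z = 0) : z = 0 := by
  have hA := BettiCofan.isClopenPartition_range_map hcol
  obtain ⟨hc⟩ := Literature.AlgebraicGeometry.Morphisms.isColimit_cofan_left hcol
  haveI : ∀ c, IsOpenImmersion (inj c).left := fun c ↦
    Literature.AlgebraicGeometry.Morphisms.isOpenImmersion_of_isColimit_cofan hc c
  refine singularCohomology.eq_zero_of_forall_map_subsetIncl_eq_zero (R := ℂ) (M := ℂ) hA fun c ↦ ?_
  -- the homeomorphism `Y_c(ℂ) ≃ₜ im (inj_c)(ℂ)` and `subsetIncl ∘ e_c = (inj_c)(ℂ)`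
  let e : ComplexPoints (Y c) ≃ₜ ↥(Set.range (AlgPoints.map (L := ℂ) (inj c) : ComplexPoints (Y c) → ComplexPoints X')) :=
    (AlgPoints.isOpenEmbedding_map_holds (L := ℂ) (inj c)).isEmbedding.toHomeomorph
  have hfac : (subsetIncl (Set.range (AlgPoints.map (L := ℂ) (inj c) : ComplexPoints (Y c) → ComplexPoints X'))).comp
      (e : C(ComplexPoints (Y c), ↥(Set.range (AlgPoints.map (L := ℂ) (inj c) : ComplexPoints (Y c) → ComplexPoints X')))) =
      AlgPoints.mapContinuous (L := ℂ) (inj c) := by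
    ext P
    rfl
  have key : (complexBetti.map (inj c) n).hom z =
      (singularCohomology.mapIso ℂ ℂ e n).hom ((singularCohomology.map ℂ ℂ (subsetIncl _) n).hom z) := by
    rw [singularCohomology.mapIso_hom, complexBetti.map, ← hfac, singularCohomology.map_comp, ModuleCat.hom_comp,
      LinearMap.comp_apply]
  have h0 : (singularCohomology.mapIso ℂ ℂ e n).hom ((singularCohomology.map ℂ ℂ (subsetIncl _) n).hom z) = 0 := by
    rw [← key, hz c]
  have hinj : Function.Injective (singularCohomology.mapIso ℂ ℂ e n).hom :=
    (singularCohomology.mapIso ℂ ℂ e n).toLinearEquiv.injective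
  exact hinj (h0.trans (map_zero _).symm)

/-- Two classes with the same restrictions to all legs of a colimit cofan are equal. [cite: HatcherAT2002, §3.1 p. 202] -/
theorem complexBetti_eq_of_forall_map_inj (hcol : IsColimit (Cofan.mk X' inj)) {n : ℕ} {z₁ z₂ : complexBetti X' n}
    (hz : ∀ c, (complexBetti.map (inj c) n).hom z₁ = (complexBetti.map (inj c) n).hom z₂) : z₁ = z₂ := by
  rw [← sub_eq_zero]
  exact complexBetti_eq_zero_of_forall_map_inj hcol fun c ↦ by rw [map_sub, hz c, sub_self]

omit [Small.{0} κ] in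
/-- **A morphism from an irreducible scheme into the apex of a colimit cofan factors through one leg**: the legs are open
immersions with open-and-closed, covering images, and the irreducible image meets one of them.
[cite: GortzWedhorn2020, §(3.5) Example 3.11] [cite: Liu2021, §2.1 Def. 2.1 (2) (l. 1175–1177)] -/
theorem exists_factor_inj [Small.{0} κ] (hcol : IsColimit (Cofan.mk X' inj)) {T : SchemeOver ℂ} [IrreducibleSpace T.left]
    (g : T ⟶ X') : ∃ (c : κ) (w : T ⟶ Y c), w ≫ inj c = g := by
  obtain ⟨t₀⟩ := (inferInstance : Nonempty T.left)
  obtain ⟨c, y, hy⟩ := exists_eq_left_of_isColimit hcol (g.left t₀)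
  haveI := isOpenImmersion_left_of_isColimit hcol c
  have hsub : Set.range g.left ⊆ Set.range (inj c).left :=
    (isPreconnected_range g.left.continuous).subset_isClopen (isClopen_range_left_of_isColimit hcol c)
      ⟨g.left t₀, ⟨t₀, rfl⟩, ⟨y, hy⟩⟩
  let w₀ := IsOpenImmersion.lift (inj c).left g.left hsub
  have hw₀ : w₀ ≫ (inj c).left = g.left := IsOpenImmersion.lift_fac _ _ _
  refine ⟨c, Over.homMk w₀ ?_, Over.OverMorphism.ext hw₀⟩
  rw [← Over.w (inj c), ← Category.assoc, hw₀]
  exact Over.w g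

end Pieces

/-! ## §4 Naturality for α-compatible pairs -/

/-- **Translations act trivially on `Hⁱ(A(ℂ); ℂ)`**: the right translate `f · c` of `f : T → A` induces the same map as `f` on complex
cohomology (right translation is homotopic to the identity of the path-connected group `A(ℂ)`; the `ℂ`-coefficient copy of the tree's
`AbelianVariety.bettiCohomology_map_mul_const`). [cite: HatcherAT2002, §3.1 p. 201] [cite: Liu2021, proof of Lemma 2.4 (1) (l. 1226–1228)] -/
theorem complexBetti_map_mul_const' {A : AbelianVariety ℂ} {T : SchemeOver ℂ} (f : T ⟶ A.X) (c : A.Points ℂ) (i : ℕ) :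
    complexBetti.map (f * (toSpecOver T ≫ c)) i = complexBetti.map f i := by
  rw [complexBetti.map, AbelianVariety.mapContinuous_mul_const, singularCohomology.map_comp,
    singularCohomology.map_eq_of_homotopic' ℂ ℂ (ContinuousMap.homotopic_mulRight_id c) i, singularCohomology.map_id,
    Category.id_comp]

namespace AlbanesePieces

variable {X Z : SchemeOver k} (D : AlbanesePieces X) (G : AlbanesePieces Z) (a : Albanese X) (b : Albanese Z)
  (v : X ⟶ Z) (nv : a.nabla.N ⟶ b.nabla.N) (φ : a.Alb ⟶ b.Alb)

/-- **Naturality of `(α)_x^*` for an α-compatible pair, on one piece.**  For `v : X ⟶ Z`, `nv : ∇X ⟶ ∇Z` over `v × v` and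
`φ : Alb_X ⟶ Alb_Z` with `α_X ≫ φ = nv ≫ α_Z`, and a piece `Y_q` of `X ⊗ ℂ` mapping through the piece `Y'_{q'}` of `Z ⊗ ℂ` by `w`:
`((α_X)_x|_{Y_q} ≫ φ_ℂ)^* = (w ≫ (α_Z)_{x'}|_{Y'_{q'}})^*` on `Hⁱ((Alb_Z ⊗ ℂ)(ℂ); ℂ)` — the transition square
(`D2Bridge.albOnPiece_comp_baseChange`) followed by the change of base point from `w(x_q)` to `x'_{q'}`, a translation
(`D2Bridge.albOnPiece_eq_mul_const`), invisible on cohomology. [cite: Liu2021, Def. 2.3 (l. 1206–1208) and proof of Lemma 2.4 (1) (l. 1226–1228)] -/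
theorem complexBetti_map_albOnPieceAt_comp (hnv : nv ≫ b.nabla.incl = a.nabla.incl ≫ (v ⊗ₘ v))
    (hφ : a.α ≫ φ.hom.hom.hom = nv ≫ b.α) (q : D.Ξ) (q' : G.Ξ) (w : D.Y q ⟶ G.Y q')
    (hw : w ≫ G.inj q' = D.inj q ≫ (bcFunctor k ℂ).map v) (i : ℕ) :
    complexBetti.map (D.albOnPieceAt a q ≫ (AbelianVariety.Hom.baseChange ℂ φ).hom.hom.hom) i =
      complexBetti.map (w ≫ G.albOnPieceAt b q') i := by
  haveI := D.geometricallyIrreducible q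
  haveI := G.geometricallyIrreducible q'
  -- the transition square: `(α_X)_{x_q}|_{Y_q} ≫ φ_ℂ = w ≫ (α_Z)_{w x_q}|_{Y'_{q'}}`
  have hsq : D.albOnPieceAt a q ≫ (AbelianVariety.Hom.baseChange ℂ φ).hom.hom.hom =
      w ≫ albOnPiece b (G.inj q') (D.pt q ≫ w) :=
    albOnPiece_comp_baseChange b (G.inj q') a v nv φ (D.inj q) w hnv hφ hw (D.pt q)
  -- change of base point on `Y'_{q'}`: a translation
  obtain ⟨c, hc⟩ := albOnPiece_eq_mul_const b (G.inj q') (G.smoothProjective q') (G.pt q') (D.pt q ≫ w)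
  have hc' : w ≫ albOnPiece b (G.inj q') (D.pt q ≫ w) = (w ≫ G.albOnPieceAt b q') * (toSpecOver (D.Y q) ≫ c) := by
    change w ≫ albOnPiece b (G.inj q') (D.pt q ≫ w) = (w ≫ albOnPiece b (G.inj q') (G.pt q')) * _
    rw [hc, MonObj.comp_mul, ← Category.assoc, Jacobian.comp_toSpecOver]
  rw [hsq, hc', complexBetti_map_mul_const']

/-- **Naturality of `(α)_x^*` for an α-compatible pair**: `((α_X)_x ≫ φ_ℂ)^* = (v_ℂ ≫ (α_Z)_{x'})^*` on `Hⁱ((Alb_Z ⊗ ℂ)(ℂ); ℂ)` — checked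
on each piece of `X ⊗ ℂ` (`complexBetti_eq_of_forall_map_inj`), which maps through one piece of `Z ⊗ ℂ` (`exists_factor_inj`).
[cite: Liu2021, Def. 2.3 (l. 1206–1208) and proof of Lemma 2.4 (1) (l. 1220–1228)] -/
theorem complexBetti_map_albAt_natural (hnv : nv ≫ b.nabla.incl = a.nabla.incl ≫ (v ⊗ₘ v))
    (hφ : a.α ≫ φ.hom.hom.hom = nv ≫ b.α) (i : ℕ) (y : complexBetti (b.Alb.baseChange ℂ).X i) :
    (complexBetti.map (D.albAt a) i).hom ((complexBetti.map (AbelianVariety.Hom.baseChange ℂ φ).hom.hom.hom i).hom y) =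
      (complexBetti.map ((bcFunctor k ℂ).map v) i).hom ((complexBetti.map (G.albAt b) i).hom y) := by
  haveI : Small.{0} D.Ξ := inferInstance
  haveI : Small.{0} G.Ξ := inferInstance
  refine complexBetti_eq_of_forall_map_inj D.isColimit fun q ↦ ?_
  haveI := D.geometricallyIrreducible q
  haveI : IrreducibleSpace (D.Y q).left := GeometricallyIrreducible.irreducibleSpace_of_subsingleton (D.Y q).hom
  obtain ⟨q', w, hw⟩ := exists_factor_inj G.isColimit (D.inj q ≫ (bcFunctor k ℂ).map v)
  have h1 : (complexBetti.map (D.inj q) i).hom ((complexBetti.map (D.albAt a) i).hom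
      ((complexBetti.map (AbelianVariety.Hom.baseChange ℂ φ).hom.hom.hom i).hom y)) =
      (complexBetti.map (D.albOnPieceAt a q ≫ (AbelianVariety.Hom.baseChange ℂ φ).hom.hom.hom) i).hom y := by
    rw [← D.inj_albAt_assoc a q, complexBetti.map_comp, complexBetti.map_comp, ModuleCat.hom_comp, ModuleCat.hom_comp,
      LinearMap.comp_apply, LinearMap.comp_apply]
  have h2 : (complexBetti.map (D.inj q) i).hom ((complexBetti.map ((bcFunctor k ℂ).map v) i).hom
      ((complexBetti.map (G.albAt b) i).hom y)) = (complexBetti.map (w ≫ G.albOnPieceAt b q') i).hom y := by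
    rw [← G.inj_albAt b q', ← Category.assoc, hw, Category.assoc, complexBetti.map_comp, complexBetti.map_comp,
      ModuleCat.hom_comp, ModuleCat.hom_comp, LinearMap.comp_apply, LinearMap.comp_apply]
  rw [h1, h2, D.complexBetti_map_albOnPieceAt_comp G a b v nv φ hnv hφ q q' w hw i]

end AlbanesePieces

/-! ## §5 The comparison family -/

section Family

open Classical in
/-- **The comparison map `cmp X a : H¹_{B}(Alb_X ⊗ ℂ, ℂ) → H¹_{B}(X ⊗ ℂ, ℂ)`** for the algebra structure `k → ℂ` in force:
`((α_X)_x)^*` for CHOSEN pieces and base points of `X ⊗_k ℂ` when such exist (always, for `X` smooth projective: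
`nonempty_albanesePieces`), and `0` otherwise. [cite: Liu2021, Lemma 2.4 (1) (l. 1210–1213) with proof (l. 1220–1228)] -/
def albaneseH1Cmp (X : SchemeOver k) (a : Albanese X) :
    complexBetti (a.Alb.baseChange ℂ).X 1 →ₗ[ℂ] complexBetti ((bcFunctor k ℂ).obj X) 1 :=
  if hD : Nonempty (AlbanesePieces X) then (complexBetti.map ((Classical.choice hD).albAt a) 1).hom else 0

/-- On a scheme with pieces, `cmp` is `((α_X)_x)^*` for the chosen pieces. [cite: Liu2021, proof of Lemma 2.4 (1) (l. 1220–1222)] -/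
theorem albaneseH1Cmp_eq (X : SchemeOver k) (a : Albanese X) (hD : Nonempty (AlbanesePieces X)) :
    albaneseH1Cmp X a = (complexBetti.map ((Classical.choice hD).albAt a) 1).hom := by
  rw [albaneseH1Cmp, dif_pos hD]

/-- **`cmp X a` is bijective for `X` smooth projective** (given Lemma 2.4 (1)). [cite: Liu2021, Lemma 2.4 (1) (l. 1210–1213)] -/
theorem albaneseH1Cmp_bijective (h : albanese_bettiOne_pullback_bijective) (X : SchemeOver k) (a : Albanese X) (d : ℕ)
    (hs : SmoothOfRelativeDimension d X.hom) (hp : IsProjectiveOver X) : Bijective (albaneseH1Cmp X a) := by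
  haveI := hs
  rw [albaneseH1Cmp_eq X a (nonempty_albanesePieces (d := d) X hp)]
  exact (Classical.choice (nonempty_albanesePieces (d := d) X hp)).complexBetti_map_albAt_bijective a h (d := d) hp

/-- **`cmp` is natural for α-compatible pairs between smooth projective schemes.**
[cite: Liu2021, Def. 2.3 (l. 1206–1208) and proof of Lemma 2.4 (1) (l. 1220–1228)] -/
theorem albaneseH1Cmp_natural {X Z : SchemeOver k} (a : Albanese X) (b : Albanese Z) (dX dZ : ℕ)
    (hsX : SmoothOfRelativeDimension dX X.hom) (hpX : IsProjectiveOver X) (hsZ : SmoothOfRelativeDimension dZ Z.hom)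
    (hpZ : IsProjectiveOver Z) (v : X ⟶ Z) (nv : a.nabla.N ⟶ b.nabla.N) (φ : a.Alb ⟶ b.Alb)
    (hnv : nv ≫ b.nabla.incl = a.nabla.incl ≫ (v ⊗ₘ v)) (hφ : a.α ≫ φ.hom.hom.hom = nv ≫ b.α)
    (y : complexBetti (b.Alb.baseChange ℂ).X 1) :
    albaneseH1Cmp X a ((complexBetti.map (AbelianVariety.Hom.baseChange ℂ φ).hom.hom.hom 1).hom y) =
      (complexBetti.map ((bcFunctor k ℂ).map v) 1).hom (albaneseH1Cmp Z b y) := by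
  haveI := hsX
  haveI := hsZ
  rw [albaneseH1Cmp_eq X a (nonempty_albanesePieces (d := dX) X hpX),
    albaneseH1Cmp_eq Z b (nonempty_albanesePieces (d := dZ) Z hpZ)]
  exact (Classical.choice (nonempty_albanesePieces (d := dX) X hpX)).complexBetti_map_albAt_natural
    (Classical.choice (nonempty_albanesePieces (d := dZ) Z hpZ)) a b v nv φ hnv hφ 1 y

end Family

/-- **Row III-0: THE COMPARISON FAMILY `H¹_{B,τ'}(Alb_X, ℂ) ≅ H¹_{B,τ'}(X, ℂ)`, CONSTRUCTED from [Liu2021] Lemma 2.4 (1)** (the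
named fact `albanese_bettiOne_pullback_bijective`, hypothesis `h` BY NAME) for every field `k`, every embedding `τ' : k →+* ℂ`:
`cmp X a := ((α_X)_x)^*` (Liu's pointed Albanese morphism for a choice of one complex point on each connected component of
`X ⊗_{k,τ'} ℂ`, which exists for `X` smooth projective; `0` on other `X`), bijective on smooth projective `X` (Lemma 2.4 (1), `ℚ → ℂ`
by universal coefficients), natural for α-compatible pairs («`Alb_u ∘ α = α ∘ ∇u`», Def. 2.3; «independent of the choice of `x` since
translation acts trivially», l. 1226–1228).  Inhabits B-typ02's hypothesis structure `AlbaneseH1ComparisonFamily k τ'`.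
[cite: Liu2021, Lemma 2.4 (1) (FJcycle.tex l. 1210–1213) with proof (l. 1220–1228); Def. 2.3 (l. 1202–1208)]
[cite: BirkenhakeLange2004, §11.11] -/
def albaneseH1ComparisonFamily_of_lemma24 (h : albanese_bettiOne_pullback_bijective) (k : Type) [Field k] (τ' : k →+* ℂ) :
    AlbaneseH1ComparisonFamily k τ' :=
  letI : Algebra k ℂ := algebraAlong k τ'
  { cmp := fun X a ↦ albaneseH1Cmp X a
    bijective := fun X a d hs hp ↦ albaneseH1Cmp_bijective h X a d hs hp
    natural := fun a b dX dY hsX hpX hsY hpY v nv φ hnv hφ y ↦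
      albaneseH1Cmp_natural a b dX dY hsX hpX hsY hpY v nv φ hnv hφ y }

/-- **Row III-0, existence form**: given Lemma 2.4 (1), the comparison family exists for every `(k, τ')`.
[cite: Liu2021, Lemma 2.4 (1) (FJcycle.tex l. 1210–1213)] -/
theorem nonempty_albaneseH1ComparisonFamily_of_lemma24 (h : albanese_bettiOne_pullback_bijective) (k : Type) [Field k]
    (τ' : k →+* ℂ) : Nonempty (AlbaneseH1ComparisonFamily k τ') :=
  ⟨albaneseH1ComparisonFamily_of_lemma24 h k τ'⟩

end Summit.HodgeConjecture.CorCM.D2Bridge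

end
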